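import Mathlib
import HarnessLib
import Summits.Ventures.LatticeQCDFlow.Scoring.AcceptanceMonitorBatch

/-!
# LatticeQCDFlow / Scoring — the unweighted pair acceptance `E_{q⊗q} min(1, w′/w)` OVER-STATES the
# equilibrium acceptance; on the batch, the trainer's monitor is never above the pair mean

HONEST FRAMING: exact (Metropolis-corrected) sampling algorithms for lattice gauge theory;
figures of merit are autocorrelation/cost numbers at stated couplings and volumes; no
continuum-physics claim.

Venture `LatticeQCDFlow` (cell pub-lqcd), sub-topic `Scoring`; FANOUT row 3 (`s0-u1-a`, S0-B
implementation A, GEN-6).  NEW WORK of the cell (one comonotonicity step over finite sums), not a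
published result; NO definition is introduced.  Companion of row 3's `Scoring/AcceptanceMonitorBatch`
(the trainer's `acc_est` monitor and the plug-in `V`) and row 11's `Scoring/IMHAcceptanceFromWeights`
(`acc = E_{q⊗q}[min(w, w′)]`).

## Why

The U(1) flow trainer of record documents its acceptance monitor (engine `latflow.flows_jax` 0.2.1,
`training.py` ll. 65–69) with the note that an earlier stage "used the consecutive-pair mean
`E_{q×q} min(1, w′/w)`, which over-states the acceptance of a poorly trained flow; corrected in
0.2.0-stage2" (to the self-normalised form).  This file types the population inequality behind that
note and its exact finite-batch counterpart.

## Content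

* `one_sub_mul_min_div_sub_min_nonneg` — `(1 − t)(min(1, c/t) − min(1, c)) ≥ 0` for `t > 0`,
  `c ≥ 0`: the current-state factor `1 − w` and the pair acceptance `min(1, w′/w)` are comonotone
  (both non-increasing) in the current weight `w`;
* **`accRate_le_qq_min_one_div_weight`** — for a fully supported normalised target `p`, a positive
  normalised model `q`, `w = p/q`:  `acc(p, q) = E_{q⊗q}[min(w, w′)] ≤ E_{q⊗q}[min(1, w′/w)]`.
  Drawing the CURRENT state from the model instead of the target (which is what an average of the
  Metropolis ratio over independent proposal pairs does) can only over-state the stationary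
  acceptance: `E_{q⊗q}[min(1,w′/w)] − acc = Σ_y q_y Σ_x q_x (1 − w_x)(min(1, w_y/w_x) − min(1, w_y)) ≥ 0`;
* **`plugIn_le_pairMean`** — on every positive batch `W_1..W_n`:
  `Σ_iΣ_j min(W_i, W_j)/(nΣW) ≤ Σ_iΣ_j min(1, W_j/W_i)/n²` (the population law at the empirical
  measure, where `w_j/w_i = W_j/W_i`);
* **`accMonitor_le_pairMean`** — with `n ≥ 2`: `acc_est = Σ_{i≠j} min(W_i,W_j)/((n−1)ΣW)
  ≤ Σ_{i≠j} min(1, W_j/W_i)/(n(n−1))`, the diagonal-free (U-statistic) form of the same comparison.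

Reading (value-free; no number of record moves, nothing is re-scored): the all-pairs unweighted
mean of `min(1, W_j/W_i)` on a batch is an UPPER bound for the monitor on that same batch, always;
its population target `E_{q⊗q} min(1, w′/w)` exceeds the equilibrium acceptance by the displayed
comonotone covariance, which is large exactly when the weights are far from constant (a poorly
trained flow).  NOT CLAIMED: anything about the CONSECUTIVE-pair sub-sample `(i, i+1)` of a batch
beyond its having the same population target; strictness / the equality case; any number of ours.

Elementary (`[folklore]`-level); farm `lean check` rc 0, no `sorry`.
-/

namespace Summit.Ventures.LatticeQCDFlow.Theory2

open Finset
open Literature.Probability.MarkovChains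
open Summit.Ventures.LatticeQCDFlow.Exactness

variable {X : Type*} [Fintype X]

/-- Termwise comonotonicity: `(1 − t)·(min(1, c/t) − min(1, c)) ≥ 0` for `t > 0`, `c ≥ 0` — the
factor `1 − t` and the pair acceptance `min(1, c/t)` are both non-increasing in `t`. [folklore] -/
theorem one_sub_mul_min_div_sub_min_nonneg {t c : ℝ} (ht : 0 < t) (hc : 0 ≤ c) :
    0 ≤ (1 - t) * (min 1 (c / t) - min 1 c) := by
  rcases le_total t 1 with h | h
  · exact mul_nonneg (sub_nonneg.2 h)
      (sub_nonneg.2 (min_le_min_left 1 (le_div_self hc ht h)))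
  · exact mul_nonneg_of_nonpos_of_nonpos (sub_nonpos.2 h)
      (sub_nonpos.2 (min_le_min_left 1 (div_le_self hc h)))

/-- **The unweighted pair acceptance over-states the equilibrium acceptance.**  For a fully
supported normalised target `p`, a positive normalised model `q` and `w = p/q`:
`acc(p, q) = E_{q⊗q}[min(w, w′)] ≤ E_{q⊗q}[min(1, w′/w)]` — averaging the Metropolis ratio over two
INDEPENDENT PROPOSALS (current state drawn from the model instead of the target) can only
over-state the stationary acceptance; equality iff the weights are `q`-a.s. constant is not typed.
Proof: the difference is `Σ_y q_y Σ_x q_x (1 − w_x)·min(1, w_y/w_x)`, and for each `y` the inner sum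
is `Σ_x q_x (1 − w_x)(min(1, w_y/w_x) − min(1, w_y)) ≥ 0` termwise (`E_q(1 − w) = 0`). -/
theorem accRate_le_qq_min_one_div_weight {p q : X → ℝ} (hp : ∀ x, 0 < p x) (hq : ∀ x, 0 < q x)
    (hp1 : ∑ x, p x = 1) (hq1 : ∑ x, q x = 1) :
    accRate p q ≤ ∑ x, ∑ y, q x * q y * min 1 (weight p q y / weight p q x) := by
  have hw : ∀ x, 0 < weight p q x := fun x => div_pos (hp x) (hq x)
  have hS1 : ∑ x, q x * weight p q x = 1 := sum_mul_weight hq hp1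
  rw [Scoring.accRate_eq_qq_min_weight hq]
  -- termwise `min(w_x, w_y) = w_x · min(1, w_y / w_x)`
  have hmin : ∀ x y, min (weight p q x) (weight p q y)
      = weight p q x * min 1 (weight p q y / weight p q x) := by
    intro x y
    rw [mul_min_of_nonneg _ _ (hw x).le, mul_one, mul_div_cancel₀ _ (hw x).ne']
  simp_rw [hmin]
  rw [← sub_nonneg]
  -- the difference, with the `y`-sum outside
  have hdiff : ∑ x, ∑ y, q x * q y * min 1 (weight p q y / weight p q x)
        - ∑ x, ∑ y, q x * q y * (weight p q x * min 1 (weight p q y / weight p q x))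
      = ∑ y, q y * ∑ x, q x * (1 - weight p q x)
          * (min 1 (weight p q y / weight p q x) - min 1 (weight p q y)) := by
    rw [← sum_sub_distrib]
    simp_rw [← sum_sub_distrib]
    rw [Finset.sum_comm]
    refine sum_congr rfl fun y _ => ?_
    rw [mul_sum]
    -- add the vanishing term `q_y · min(1, w_y) · Σ_x q_x (1 − w_x) = 0`
    have h0 : ∑ x, q y * (q x * (1 - weight p q x) * min 1 (weight p q y)) = 0 := by
      have e : ∀ x, q y * (q x * (1 - weight p q x) * min 1 (weight p q y))
          = q y * min 1 (weight p q y) * q x - q y * min 1 (weight p q y) * (q x * weight p q x) :=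
        fun x => by ring
      simp_rw [e]
      rw [sum_sub_distrib, ← mul_sum, ← mul_sum, hq1, hS1, sub_self]
    rw [← sub_zero (∑ x, (q x * q y * min 1 (weight p q y / weight p q x)
      - q x * q y * (weight p q x * min 1 (weight p q y / weight p q x)))), ← h0, ← sum_sub_distrib]
    exact sum_congr rfl fun x _ => by ring
  rw [hdiff]
  exact sum_nonneg fun y _ => mul_nonneg (hq y).le (sum_nonneg fun x _ => by
    rw [mul_assoc]
    exact mul_nonneg (hq x).le (one_sub_mul_min_div_sub_min_nonneg (hw x) (hw y).le))

end Summit.Ventures.LatticeQCDFlow.Theory2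

namespace Summit.Ventures.LatticeQCDFlow.Scoring

open Finset
open Summit.Ventures.LatticeQCDFlow.Exactness
open Summit.Ventures.LatticeQCDFlow.Theory2

variable {ι : Type*} [Fintype ι]

/-- **On the batch: the unweighted all-pairs mean of `min(1, W_j/W_i)` is never below the plug-in
acceptance** `Σ_iΣ_j min(W_i, W_j)/(nΣW)` (positive weights; the population law at the empirical
measure, where `w_j/w_i = W_j/W_i`). -/
theorem plugIn_le_pairMean [Nonempty ι] {W : ι → ℝ} (hW : ∀ i, 0 < W i) :
    (∑ i, ∑ j, min (W i) (W j)) / (Fintype.card ι * ∑ i, W i)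
      ≤ (∑ i, ∑ j, min 1 (W j / W i)) / (Fintype.card ι : ℝ) ^ 2 := by
  have hS : 0 < ∑ j, W j := sum_pos (fun i _ => hW i) univ_nonempty
  have hn : 0 < (Fintype.card ι : ℝ) := Nat.cast_pos.2 Fintype.card_pos
  have h := accRate_le_qq_min_one_div_weight (p := fun i => W i / ∑ j, W j)
    (q := fun _ => ((Fintype.card ι : ℝ))⁻¹) (fun i => div_pos (hW i) hS)
    (fun _ => inv_pos.2 hn) (sum_selfNorm_eq_one hW) sum_uniform_eq_one
  rw [accRate_selfNorm_uniform hW] at h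
  refine h.trans (le_of_eq ?_)
  simp only [weight]
  have e : ∀ i j, ((Fintype.card ι : ℝ))⁻¹ * ((Fintype.card ι : ℝ))⁻¹
      * min 1 (W j / (∑ k, W k) / ((Fintype.card ι : ℝ))⁻¹ / (W i / (∑ k, W k) / ((Fintype.card ι : ℝ))⁻¹))
      = min 1 (W j / W i) / (Fintype.card ι : ℝ) ^ 2 := by
    intro i j
    have hWi : W i ≠ 0 := (hW i).ne'
    have e2 : W j / (∑ k, W k) / ((Fintype.card ι : ℝ))⁻¹ / (W i / (∑ k, W k) / ((Fintype.card ι : ℝ))⁻¹)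
        = W j / W i := by
      field_simp
    rw [e2]
    field_simp
  simp_rw [e, ← sum_div]

/-- **The trainer's monitor is never above the unweighted off-diagonal pair mean**: with `n ≥ 2`
positive proposals, `Σ_{i≠j} min(W_i,W_j)/((n−1)ΣW) ≤ Σ_{i≠j} min(1, W_j/W_i)/(n(n−1))` — the
all-pairs form of the engine note that the pair mean `E_{q×q} min(1, w′/w)` (flows_jax 0.2.0-stage1)
over-states the acceptance that the self-normalised monitor (0.2.0-stage2 onward) estimates. -/
theorem accMonitor_le_pairMean [DecidableEq ι] {W : ι → ℝ} (hW : ∀ i, 0 < W i)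
    (hn : 2 ≤ Fintype.card ι) :
    (∑ i, ∑ j ∈ univ.erase i, min (W i) (W j)) / ((Fintype.card ι - 1) * ∑ i, W i)
      ≤ (∑ i, ∑ j ∈ univ.erase i, min 1 (W j / W i))
          / ((Fintype.card ι : ℝ) * (Fintype.card ι - 1)) := by
  haveI : Nonempty ι := Fintype.card_pos_iff.1 (by omega)
  have hS : 0 < ∑ j, W j := sum_pos (fun i _ => hW i) univ_nonempty
  have hnpos : 0 < (Fintype.card ι : ℝ) := Nat.cast_pos.2 Fintype.card_pos
  have hn1 : 0 < (Fintype.card ι : ℝ) - 1 := by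
    have : (2 : ℝ) ≤ Fintype.card ι := by exact_mod_cast hn
    linarith
  -- remove the diagonals: `min(W_i, W_i) = W_i`, `min(1, W_i/W_i) = 1`
  have hdiag : ∑ i, ∑ j ∈ univ.erase i, min 1 (W j / W i)
      = ∑ i, ∑ j, min 1 (W j / W i) - Fintype.card ι := by
    have h : ∀ i, ∑ j ∈ univ.erase i, min 1 (W j / W i) = ∑ j, min 1 (W j / W i) - 1 := fun i => by
      rw [sum_erase_eq_sub (mem_univ i), div_self (hW i).ne', min_self]
    simp_rw [h]
    rw [sum_sub_distrib, sum_const, card_univ, nsmul_eq_mul, mul_one]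
  rw [sum_erase_min_eq, hdiag]
  have h := plugIn_le_pairMean hW
  rw [div_le_div_iff₀ (mul_pos hnpos hS) (pow_pos hnpos 2)] at h
  rw [div_le_div_iff₀ (mul_pos hn1 hS) (mul_pos hnpos hn1)]
  nlinarith [h, hS, hnpos, hn1]

end Summit.Ventures.LatticeQCDFlow.Scoring
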